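import Literature.NumberTheory.LFunctions.JensenShiftCertificate
import Literature.NumberTheory.LFunctions.JensenAsymptotics
import HarnessLib

/-!
# The renormalised degree-`4` Jensen polynomials of `ξ` in MOMENT FORM: an exact polynomial in
# `δ = (2n+1)^{-1/2}` and the normalised central moments `μ_l = m_l(2n)/δ^l`

Griffin–Ono–Rolen–Zagier (PNAS 116 (2019), Thm. 3 and §5.2) renormalise
`Ĵ^{d,n}_γ(X) = δ(n)^{-d} γ(n)⁻¹ J^{d,n}_γ((δ(n)X - 1)/e^{A(n)}) = Σ β^{d,n}_k X^k → H_d(X)` with the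
transcendental `A(n), δ(n)` of their (18). Hyperbolicity being invariant under the affine change of
variable, ANY explicit normalisation is admissible; with the tree's exact moment identities
(`γ(n) = 64·4ⁿ·n!/(2n)!·M_{2n}`, `xiTaylorCoeff_eq_xiMoment`;
`M_{k+r}/M_k = ū_k^r Σ_{l ≤ r} C(r,l) m_l(k)`, `xiMoment_add_div`) the choice

  `y = 1/(n + ½)` (`GORZAsymp.yseq`),  `δ₁(n) := √(y/2) = (2n+1)^{-1/2}`,
  `E₁(n) := ū_{2n}² · y · (1 + y/2)`  (`ū_k = M_{k+1}/M_k`, `xiMean`)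

makes `γ(n+j)/(γ(n) E₁(n)^j) = (1 + Σ_{2 ≤ l ≤ 2j} C(2j,l) m_l(2n)) / ((1 + y/2)^j Π_{t<j} (1 + t y))`
(`xiTaylorCoeff_add_mul_prod`), so that after clearing the positive factor
`c₄(n) := (1 + y/2)⁴ Π_{t<4}(1 + t y)` the renormalised polynomial is an EXPLICIT POLYNOMIAL with
integer coefficients in `δ₁`, `μ_l := m_l(2n)/δ₁^l` (`2 ≤ l ≤ 8`) and `X` — the negative powers of `δ₁`
cancel identically (the `d`-th-difference structure GORZ exploit; here a finite `ring` identity):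

  `c₄(n) · Ĵ^{4,n}(X) = P₄(δ₁(n), μ₂(n), …, μ₈(n); X)`  (`cFour_mul_eval_jensenPolyRescaled_four`),

`P₄ = gorzPolyFour` (112 monomials; its `δ = μ = 0` part is `H₄ = X⁴ - 12X² + 12`, its `O(δ)` part
`δ(28X³ - 136X + …)` reproduces the shape of GORZ's printed brackets `β₃ < 28δ`, `β₁ > -145.70δ`).
Since `m_l(2n) = o(δ₁^l)` (`isLittleO_xiCM_two_mul`), `μ_l → 0` and `Ĵ^{4,n} → H₄` (GORZ Thm. 3);
EFFECTIVE bounds `|μ_l(n)| ≤ μ̄_l` on a range of `n` turn the hyperbolicity of `J^{4,n}_γ` on that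
range into the sign pattern of the explicit `P₄` over a box in `(δ, μ)` — a decidable certificate
(a follow-up file). This file is the exact algebra only.

## References
* [GORZPNAS2019] Griffin–Ono–Rolen–Zagier, PNAS 116 (2019), Thm. 3 eq. (5), §5.1 (15)–(18), §5.2.
-/

noncomputable section

open Polynomial Finset Real
open scoped Nat

namespace Literature.NumberTheory.LFunctions

open GORZAsymp

/-! ## The explicit normalisation -/

/-- `δ₁(n) := √(y/2)`, `y = 1/(n + ½)`; so `δ₁(n)² = 1/(2n + 1)`. An admissible explicit choice of
GORZ's `δ(n)` (same leading order as (18)). [cite: GORZPNAS2019, §5.1 eq. (18)] -/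
def deltaOne (n : ℕ) : ℝ := Real.sqrt (yseq n / 2)

/-- `E₁(n) := ū_{2n}² · y · (1 + y/2)` — an admissible explicit replacement of GORZ's `e^{A(n)}`
(`A(n) = log(ū²y) + y/2 + o(y)`; `1 + y/2` is the first-order truncation of `e^{y/2}`).
[cite: GORZPNAS2019, §5.1 eq. (18)] -/
def EOne (n : ℕ) : ℝ := xiMean (2 * n) ^ 2 * yseq n * (1 + yseq n / 2)

/-- The normalised central moments at scale `δ₁`: `μ_l(n) := m_l(2n)/δ₁(n)^l` (`→ 0`, GORZ Thm. 7 /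
the tree's `isLittleO_xiCM_two_mul`). [cite: GORZPNAS2019, §5.1 eq. (15)] -/
def xiMu (n l : ℕ) : ℝ := xiCM (2 * n) l / deltaOne n ^ l

/-- The positive clearing factor `c₄(n) = (1 + y/2)⁴ (1 + y)(1 + 2y)(1 + 3y)` (non-Prop plumbing). [folklore] -/
def cFour (n : ℕ) : ℝ :=
  (1 + yseq n / 2) ^ 4 * ((1 + yseq n) * (1 + 2 * yseq n) * (1 + 3 * yseq n))

/-- `δ₁(n) > 0` (admissibility of the normalisation). [cite: GORZPNAS2019, §5.1 eq. (18)] -/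
theorem deltaOne_pos (n : ℕ) : 0 < deltaOne n := by
  unfold deltaOne; exact Real.sqrt_pos.2 (by have := yseq_pos n; positivity)

/-- `δ₁(n)² = y/2`. [cite: GORZPNAS2019, §5.1 eq. (18)] -/
theorem deltaOne_sq (n : ℕ) : deltaOne n ^ 2 = yseq n / 2 := by
  unfold deltaOne; rw [Real.sq_sqrt (by have := yseq_pos n; positivity)]

/-- `c₄(n) > 0`. [cite: GORZPNAS2019, §5.2] -/
theorem cFour_pos (n : ℕ) : 0 < cFour n := by
  unfold cFour; have := yseq_pos n; positivity

/-- `E₁(n) > 0` (admissibility of the normalisation). [cite: GORZPNAS2019, §5.1 eq. (18)] -/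
theorem EOne_pos (n : ℕ) : 0 < EOne n := by
  unfold EOne; have := yseq_pos n; have := xiMean_pos (2 * n); positivity

/-! ## The exact ratio `γ(n+j)/γ(n)` in moment form -/

/-- Factorial bookkeeping: `4ʲ (n+j)! (2n)! Π_{t<j}(n + t + ½) = n! (2n+2j)!`. [folklore] -/
private theorem four_pow_mul_factorial_prod (n : ℕ) : ∀ j : ℕ,
    (4 : ℝ) ^ j * ((n + j)! : ℝ) * ((2 * n)! : ℝ) * ∏ t ∈ range j, ((n : ℝ) + t + 1 / 2) =
      (n ! : ℝ) * ((2 * (n + j))! : ℝ)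
  | 0 => by simp
  | j + 1 => by
    rw [prod_range_succ, show n + (j + 1) = n + j + 1 from rfl, Nat.factorial_succ,
      show 2 * (n + j + 1) = 2 * (n + j) + 1 + 1 by ring, Nat.factorial_succ, Nat.factorial_succ]
    have ih := four_pow_mul_factorial_prod n j
    push_cast at ih ⊢
    linear_combination (4 * ((n : ℝ) + j + 1) * ((n : ℝ) + j + 1 / 2)) * ih

/-- **`γ(n+j)` in moment form**: `γ(n+j) · Π_{t<j}(n + t + ½) = γ(n) · ū_{2n}^{2j} · Σ_{l ≤ 2j} C(2j,l) m_l(2n)`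
(from `γ(n) = 64·4ⁿ n!/(2n)! M_{2n}` and `M_{2n+2j}/M_{2n} = ū^{2j} Σ C(2j,l) m_l`).
[cite: GORZPNAS2019, §5.1 eq. (15)] -/
theorem xiTaylorCoeff_add_mul_prod (n j : ℕ) :
    xiTaylorCoeff (n + j) * ∏ t ∈ range j, ((n : ℝ) + t + 1 / 2) =
      xiTaylorCoeff n * xiMean (2 * n) ^ (2 * j) *
        ∑ l ∈ range (2 * j + 1), ((2 * j).choose l : ℝ) * xiCM (2 * n) l := by
  have hM := (xiMoment_pos (2 * n)).ne'
  have hratio := xiMoment_add_div (2 * n) (2 * j)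
  rw [div_eq_iff hM] at hratio
  rw [xiTaylorCoeff_eq_xiMoment, xiTaylorCoeff_eq_xiMoment, show 2 * (n + j) = 2 * n + 2 * j by ring,
    hratio]
  have hf := four_pow_mul_factorial_prod n j
  rw [show 2 * (n + j) = 2 * n + 2 * j by ring] at hf
  have h1 : ((2 * n + 2 * j)! : ℝ) ≠ 0 := by exact_mod_cast Nat.factorial_ne_zero _
  have h2 : ((2 * n)! : ℝ) ≠ 0 := by exact_mod_cast Nat.factorial_ne_zero _
  generalize ∏ t ∈ range j, ((n : ℝ) + t + 1 / 2) = P at hf ⊢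
  generalize ∑ l ∈ range (2 * j + 1), ((2 * j).choose l : ℝ) * xiCM (2 * n) l = S
  have key : (4 : ℝ) ^ (n + j) * ((n + j)! : ℝ) * P / ((2 * n + 2 * j)! : ℝ) =
      4 ^ n * (n ! : ℝ) / ((2 * n)! : ℝ) := by
    rw [div_eq_div_iff h1 h2, pow_add]
    linear_combination (4 : ℝ) ^ n * hf
  calc 64 * 4 ^ (n + j) * ((n + j)! : ℝ) / ((2 * n + 2 * j)! : ℝ) *
        (xiMean (2 * n) ^ (2 * j) * S * xiMoment (2 * n)) * P
      = 64 * (4 ^ (n + j) * ((n + j)! : ℝ) * P / ((2 * n + 2 * j)! : ℝ)) *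
        (xiMean (2 * n) ^ (2 * j) * S * xiMoment (2 * n)) := by ring
    _ = 64 * (4 ^ n * (n ! : ℝ) / ((2 * n)! : ℝ)) *
        (xiMean (2 * n) ^ (2 * j) * S * xiMoment (2 * n)) := by rw [key]
    _ = 64 * 4 ^ n * (n ! : ℝ) / ((2 * n)! : ℝ) * xiMoment (2 * n) * xiMean (2 * n) ^ (2 * j) * S := by
        ring

/-- The same in `δ`-form: with `n + ½ = 1/(2δ²)` (`δ = δ₁(n)`),
`γ(n+j) · Π_{t<j}(1 + 2tδ²) = γ(n) · ū^{2j} · (2δ²)^j · Σ_{l ≤ 2j} C(2j,l) m_l(2n)`.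
[cite: GORZPNAS2019, §5.1 eq. (15)] -/
theorem xiTaylorCoeff_add_mul_prod_delta (n j : ℕ) :
    xiTaylorCoeff (n + j) * ∏ t ∈ range j, (1 + 2 * t * deltaOne n ^ 2) =
      xiTaylorCoeff n * xiMean (2 * n) ^ (2 * j) * (2 * deltaOne n ^ 2) ^ j *
        ∑ l ∈ range (2 * j + 1), ((2 * j).choose l : ℝ) * xiCM (2 * n) l := by
  have hδ := (deltaOne_pos n).ne'
  have h2δ : 2 * deltaOne n ^ 2 ≠ 0 := by positivity
  have hn : ((n : ℝ) + 1 / 2) * (2 * deltaOne n ^ 2) = 1 := by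
    rw [deltaOne_sq, yseq]; field_simp
  have hprod : ∀ i : ℕ, (∏ t ∈ range i, ((n : ℝ) + t + 1 / 2)) * (2 * deltaOne n ^ 2) ^ i =
      ∏ t ∈ range i, (1 + 2 * t * deltaOne n ^ 2) := by
    intro i
    induction i with
    | zero => simp
    | succ i ih =>
      have hni : ((n : ℝ) + i + 1 / 2) * (2 * deltaOne n ^ 2) = 1 + 2 * i * deltaOne n ^ 2 := by
        linear_combination hn
      rw [prod_range_succ, prod_range_succ, pow_succ, ← ih, ← hni]
      ring
  have h := xiTaylorCoeff_add_mul_prod n j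
  calc xiTaylorCoeff (n + j) * ∏ t ∈ range j, (1 + 2 * t * deltaOne n ^ 2)
      = xiTaylorCoeff (n + j) * (∏ t ∈ range j, ((n : ℝ) + t + 1 / 2)) *
          (2 * deltaOne n ^ 2) ^ j := by rw [← hprod j]; ring
    _ = xiTaylorCoeff n * xiMean (2 * n) ^ (2 * j) *
          (∑ l ∈ range (2 * j + 1), ((2 * j).choose l : ℝ) * xiCM (2 * n) l) *
          (2 * deltaOne n ^ 2) ^ j := by rw [h]
    _ = _ := by ring

/-! ## The explicit polynomial `P₄` -/

/-- Coefficient of `δ^0` in `P₄` (a polynomial in `μ₂, …, μ₈, x`; generated). [cite: GORZPNAS2019, §5.2] -/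
def gorzPolyFourQ0 (μ2 μ3 μ4 _μ5 _μ6 _μ7 _μ8 x : ℝ) : ℝ :=
  12 +
    (-12) * x ^ (2 : ℕ) +
    1 * x ^ (4 : ℕ) +
    16 * μ4 +
    (-32) * μ3 * x +
    (-48) * μ2 +
    24 * μ2 * x ^ (2 : ℕ)

/-- Coefficient of `δ^1` in `P₄` (a polynomial in `μ₂, …, μ₈, x`; generated). [cite: GORZPNAS2019, §5.2] -/
def gorzPolyFourQ1 (μ2 μ3 μ4 μ5 _μ6 _μ7 _μ8 x : ℝ) : ℝ :=
  (-136) * x +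
    28 * x ^ (3 : ℕ) +
    32 * μ5 +
    (-112) * μ4 * x +
    (-272) * μ3 +
    120 * μ3 * x ^ (2 : ℕ) +
    456 * μ2 * x +
    (-52) * μ2 * x ^ (3 : ℕ)

/-- Coefficient of `δ^2` in `P₄` (a polynomial in `μ₂, …, μ₈, x`; generated). [cite: GORZPNAS2019, §5.2] -/
def gorzPolyFourQ2 (μ2 μ3 μ4 μ5 μ6 _μ7 _μ8 x : ℝ) : ℝ :=
  (-220) +
    198 * x ^ (2 : ℕ) +
    24 * μ6 +
    (-152) * μ5 * x +
    (-348) * μ4 +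
    246 * μ4 * x ^ (2 : ℕ) +
    1104 * μ3 * x +
    (-144) * μ3 * x ^ (3 : ℕ) +
    928 * μ2 +
    (-828) * μ2 * x ^ (2 : ℕ) +
    28 * μ2 * x ^ (4 : ℕ)

/-- Coefficient of `δ^3` in `P₄` (a polynomial in `μ₂, …, μ₈, x`; generated). [cite: GORZPNAS2019, §5.2] -/
def gorzPolyFourQ3 (μ2 μ3 μ4 μ5 μ6 μ7 _μ8 x : ℝ) : ℝ :=
  172 * x +
    24 * x ^ (3 : ℕ) +
    8 * μ7 +
    (-100) * μ6 * x +
    (-168) * μ5 +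
    264 * μ5 * x ^ (2 : ℕ) +
    1116 * μ4 * x +
    (-220) * μ4 * x ^ (3 : ℕ) +
    600 * μ3 +
    (-1392) * μ3 * x ^ (2 : ℕ) +
    56 * μ3 * x ^ (4 : ℕ) +
    (-1828) * μ2 * x +
    420 * μ2 * x ^ (3 : ℕ)

/-- Coefficient of `δ^4` in `P₄` (a polynomial in `μ₂, …, μ₈, x`; generated). [cite: GORZPNAS2019, §5.2] -/
def gorzPolyFourQ4 (μ2 μ3 μ4 μ5 μ6 μ7 μ8 x : ℝ) : ℝ :=
  (-503) +
    348 * x ^ (2 : ℕ) +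
    1 * μ8 +
    (-32) * μ7 * x +
    (-28) * μ6 +
    156 * μ6 * x ^ (2 : ℕ) +
    504 * μ5 * x +
    (-200) * μ5 * x ^ (3 : ℕ) +
    (-90) * μ4 +
    (-1188) * μ4 * x ^ (2 : ℕ) +
    70 * μ4 * x ^ (4 : ℕ) +
    (-720) * μ3 * x +
    560 * μ3 * x ^ (3 : ℕ) +
    1220 * μ2 +
    540 * μ2 * x ^ (2 : ℕ)

/-- Coefficient of `δ^5` in `P₄` (a polynomial in `μ₂, …, μ₈, x`; generated). [cite: GORZPNAS2019, §5.2] -/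
def gorzPolyFourQ5 (μ2 μ3 μ4 μ5 μ6 μ7 μ8 x : ℝ) : ℝ :=
  864 * x +
    (-4) * μ8 * x +
    48 * μ7 * x ^ (2 : ℕ) +
    84 * μ6 * x +
    (-108) * μ6 * x ^ (3 : ℕ) +
    (-144) * μ5 +
    (-504) * μ5 * x ^ (2 : ℕ) +
    56 * μ5 * x ^ (4 : ℕ) +
    540 * μ4 * x +
    420 * μ4 * x ^ (3 : ℕ) +
    1392 * μ3 +
    (-360) * μ3 * x ^ (2 : ℕ) +
    (-3308) * μ2 * x +
    360 * μ2 * x ^ (3 : ℕ)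

/-- Coefficient of `δ^6` in `P₄` (a polynomial in `μ₂, …, μ₈, x`; generated). [cite: GORZPNAS2019, §5.2] -/
def gorzPolyFourQ6 (μ2 μ3 μ4 μ5 μ6 μ7 μ8 x : ℝ) : ℝ :=
  (-276) +
    144 * x ^ (2 : ℕ) +
    6 * μ8 * x ^ (2 : ℕ) +
    (-32) * μ7 * x ^ (3 : ℕ) +
    (-24) * μ6 +
    (-84) * μ6 * x ^ (2 : ℕ) +
    28 * μ6 * x ^ (4 : ℕ) +
    432 * μ5 * x +
    168 * μ5 * x ^ (3 : ℕ) +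
    348 * μ4 +
    (-810) * μ4 * x ^ (2 : ℕ) +
    (-2784) * μ3 * x +
    480 * μ3 * x ^ (3 : ℕ) +
    (-288) * μ2 +
    2088 * μ2 * x ^ (2 : ℕ)

/-- Coefficient of `δ^7` in `P₄` (a polynomial in `μ₂, …, μ₈, x`; generated). [cite: GORZPNAS2019, §5.2] -/
def gorzPolyFourQ7 (μ2 μ3 μ4 μ5 μ6 μ7 μ8 x : ℝ) : ℝ :=
  752 * x +
    (-4) * μ8 * x ^ (3 : ℕ) +
    8 * μ7 * x ^ (4 : ℕ) +
    72 * μ6 * x +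
    28 * μ6 * x ^ (3 : ℕ) +
    (-432) * μ5 * x ^ (2 : ℕ) +
    (-696) * μ4 * x +
    360 * μ4 * x ^ (3 : ℕ) +
    576 * μ3 +
    1392 * μ3 * x ^ (2 : ℕ) +
    (-576) * μ2 * x

/-- Coefficient of `δ^8` in `P₄` (a polynomial in `μ₂, …, μ₈, x`; generated). [cite: GORZPNAS2019, §5.2] -/
def gorzPolyFourQ8 (μ2 μ3 μ4 μ5 μ6 _μ7 μ8 x : ℝ) : ℝ :=
  44 +
    1 * μ8 * x ^ (4 : ℕ) +
    (-72) * μ6 * x ^ (2 : ℕ) +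
    144 * μ5 * x ^ (3 : ℕ) +
    144 * μ4 +
    348 * μ4 * x ^ (2 : ℕ) +
    (-1152) * μ3 * x +
    (-752) * μ2 +
    864 * μ2 * x ^ (2 : ℕ)

/-- Coefficient of `δ^9` in `P₄` (a polynomial in `μ₂, …, μ₈, x`; generated). [cite: GORZPNAS2019, §5.2] -/
def gorzPolyFourQ9 (μ2 μ3 μ4 _μ5 μ6 _μ7 _μ8 x : ℝ) : ℝ :=
  192 * x +
    24 * μ6 * x ^ (3 : ℕ) +
    (-288) * μ4 * x +
    576 * μ3 * x ^ (2 : ℕ) +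
    752 * μ2 * x

/-- Coefficient of `δ^10` in `P₄` (a polynomial in `μ₂, …, μ₈, x`; generated). [cite: GORZPNAS2019, §5.2] -/
def gorzPolyFourQ10 (μ2 _μ3 μ4 _μ5 _μ6 _μ7 _μ8 x : ℝ) : ℝ :=
  48 +
    144 * μ4 * x ^ (2 : ℕ) +
    (-192) * μ2

/-- Coefficient of `δ^11` in `P₄` (a polynomial in `μ₂, …, μ₈, x`; generated). [cite: GORZPNAS2019, §5.2] -/
def gorzPolyFourQ11 (μ2 _μ3 _μ4 _μ5 _μ6 _μ7 _μ8 x : ℝ) : ℝ :=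
  192 * μ2 * x

/-- **`P₄(δ, μ₂, …, μ₈; x) = c₄ · Ĵ^{4,n}(x)`** — the renormalised degree-`4` Jensen polynomial of `ξ`
as an explicit integer polynomial in `δ = δ₁(n)`, the normalised central moments `μ_l` and `x`
(`112` monomials, `δ`-degree `11`, generated by exact expansion; `gorzPolyFourQ0 0 … 0 x = H₄(x)
= x⁴ - 12x² + 12`). [cite: GORZPNAS2019, Thm. 3 eq. (5) and §5.2] -/
def gorzPolyFour (δ μ2 μ3 μ4 μ5 μ6 μ7 μ8 x : ℝ) : ℝ :=
  gorzPolyFourQ0 μ2 μ3 μ4 μ5 μ6 μ7 μ8 x +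
    δ ^ (1 : ℕ) * gorzPolyFourQ1 μ2 μ3 μ4 μ5 μ6 μ7 μ8 x +
    δ ^ (2 : ℕ) * gorzPolyFourQ2 μ2 μ3 μ4 μ5 μ6 μ7 μ8 x +
    δ ^ (3 : ℕ) * gorzPolyFourQ3 μ2 μ3 μ4 μ5 μ6 μ7 μ8 x +
    δ ^ (4 : ℕ) * gorzPolyFourQ4 μ2 μ3 μ4 μ5 μ6 μ7 μ8 x +
    δ ^ (5 : ℕ) * gorzPolyFourQ5 μ2 μ3 μ4 μ5 μ6 μ7 μ8 x +
    δ ^ (6 : ℕ) * gorzPolyFourQ6 μ2 μ3 μ4 μ5 μ6 μ7 μ8 x +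
    δ ^ (7 : ℕ) * gorzPolyFourQ7 μ2 μ3 μ4 μ5 μ6 μ7 μ8 x +
    δ ^ (8 : ℕ) * gorzPolyFourQ8 μ2 μ3 μ4 μ5 μ6 μ7 μ8 x +
    δ ^ (9 : ℕ) * gorzPolyFourQ9 μ2 μ3 μ4 μ5 μ6 μ7 μ8 x +
    δ ^ (10 : ℕ) * gorzPolyFourQ10 μ2 μ3 μ4 μ5 μ6 μ7 μ8 x +
    δ ^ (11 : ℕ) * gorzPolyFourQ11 μ2 μ3 μ4 μ5 μ6 μ7 μ8 x

/-! ## The identity -/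

/-- Evaluation of the renormalised Jensen polynomial (definition unfolded).
[cite: GORZPNAS2019, Thm. 3 eq. (5)] -/
theorem eval_jensenPolyRescaled (α E δ : ℕ → ℝ) (d n : ℕ) (x : ℝ) :
    (jensenPolyRescaled α E δ d n).eval x =
      (δ n)⁻¹ ^ d / α n *
        ∑ j ∈ range (d + 1), (d.choose j : ℝ) * α (n + j) * (δ n / E n * x - (E n)⁻¹) ^ j := by
  simp [jensenPolyRescaled, eval_comp, eval_jensenPoly]

/-- **`c₄(n) · Ĵ^{4,n}_γ(x) = P₄(δ₁(n), μ₂(n), …, μ₈(n); x)`** for every `n` and `x`, with the explicit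
normalisation `E₁, δ₁`: the exact moment form of the degree-`4` renormalised Jensen polynomial of
`ξ` (no asymptotics, no remainder). [cite: GORZPNAS2019, Thm. 3 eq. (5) and §5.2] -/
theorem cFour_mul_eval_jensenPolyRescaled_four (n : ℕ) (x : ℝ) :
    cFour n * (jensenPolyRescaled xiTaylorCoeff EOne deltaOne 4 n).eval x =
      gorzPolyFour (deltaOne n) (xiMu n 2) (xiMu n 3) (xiMu n 4) (xiMu n 5) (xiMu n 6) (xiMu n 7)
        (xiMu n 8) x := by
  have hδ := (deltaOne_pos n).ne'
  have hu := (xiMean_pos (2 * n)).ne'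
  have hg := (xiTaylorCoeff_pos_holds n).ne'
  have hy2 : yseq n = 2 * deltaOne n ^ 2 := by rw [deltaOne_sq]; ring
  have hm : ∀ l, xiCM (2 * n) l = xiMu n l * deltaOne n ^ l := fun l => by
    rw [xiMu, div_mul_cancel₀ _ (pow_ne_zero _ hδ)]
  -- the four shifted coefficients in δ-moment form
  have e1 := xiTaylorCoeff_add_mul_prod_delta n 1
  have e2 := xiTaylorCoeff_add_mul_prod_delta n 2
  have e3 := xiTaylorCoeff_add_mul_prod_delta n 3
  have e4 := xiTaylorCoeff_add_mul_prod_delta n 4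
  simp only [prod_range_succ, prod_range_zero, sum_range_succ, sum_range_zero, xiCM_zero,
    xiCM_one] at e1 e2 e3 e4
  norm_num [Nat.choose] at e1 e2 e3 e4
  rw [hm 2] at e1
  rw [hm 2, hm 3, hm 4] at e2
  rw [hm 2, hm 3, hm 4, hm 5, hm 6] at e3
  rw [hm 2, hm 3, hm 4, hm 5, hm 6, hm 7, hm 8] at e4
  -- abbreviate the atoms
  set δ := deltaOne n with hδdef
  set u := xiMean (2 * n) with hudef
  set g := xiTaylorCoeff n with hgdef
  have hE : EOne n = u ^ 2 * (2 * δ ^ 2) * (1 + δ ^ 2) := by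
    simp only [EOne, hy2, ← hudef]; ring
  have hc : cFour n = (1 + δ ^ 2) ^ 4 * ((1 + 2 * δ ^ 2) * (1 + 4 * δ ^ 2) * (1 + 6 * δ ^ 2)) := by
    simp only [cFour, hy2]; ring
  have h1 : (1 : ℝ) + δ ^ 2 ≠ 0 := by positivity
  have h2 : (1 : ℝ) + 2 * δ ^ 2 ≠ 0 := by positivity
  have h4 : (1 : ℝ) + 4 * δ ^ 2 ≠ 0 := by positivity
  have h6 : (1 : ℝ) + 6 * δ ^ 2 ≠ 0 := by positivity
  -- solve for γ(n+1), …, γ(n+4)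
  have f1 : xiTaylorCoeff (n + 1) =
      g * u ^ 2 * (2 * δ ^ 2) * (1 + xiMu n 2 * δ ^ 2) := by
    linear_combination e1
  have f2 : xiTaylorCoeff (n + 2) = g * u ^ 4 * (2 * δ ^ 2) ^ 2 *
      (1 + 6 * (xiMu n 2 * δ ^ 2) + 4 * (xiMu n 3 * δ ^ 3) + xiMu n 4 * δ ^ 4) / (1 + 2 * δ ^ 2) := by
    rw [eq_div_iff h2]; linear_combination e2
  have f3 : xiTaylorCoeff (n + 3) = g * u ^ 6 * (2 * δ ^ 2) ^ 3 *
      (1 + 15 * (xiMu n 2 * δ ^ 2) + 20 * (xiMu n 3 * δ ^ 3) + 15 * (xiMu n 4 * δ ^ 4) +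
        6 * (xiMu n 5 * δ ^ 5) + xiMu n 6 * δ ^ 6) / ((1 + 2 * δ ^ 2) * (1 + 4 * δ ^ 2)) := by
    rw [eq_div_iff (mul_ne_zero h2 h4)]; linear_combination e3
  have f4 : xiTaylorCoeff (n + 4) = g * u ^ 8 * (2 * δ ^ 2) ^ 4 *
      (1 + 28 * (xiMu n 2 * δ ^ 2) + 56 * (xiMu n 3 * δ ^ 3) + 70 * (xiMu n 4 * δ ^ 4) +
        56 * (xiMu n 5 * δ ^ 5) + 28 * (xiMu n 6 * δ ^ 6) + 8 * (xiMu n 7 * δ ^ 7) + xiMu n 8 * δ ^ 8) /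
        ((1 + 2 * δ ^ 2) * (1 + 4 * δ ^ 2) * (1 + 6 * δ ^ 2)) := by
    rw [eq_div_iff (mul_ne_zero (mul_ne_zero h2 h4) h6)]; linear_combination e4
  -- evaluate and substitute
  rw [eval_jensenPolyRescaled]
  simp only [sum_range_succ, sum_range_zero]
  norm_num [Nat.choose]
  rw [f1, f2, f3, f4, hE, hc, ← hδdef, ← hgdef]
  simp only [gorzPolyFour, gorzPolyFourQ0, gorzPolyFourQ1, gorzPolyFourQ2, gorzPolyFourQ3,
    gorzPolyFourQ4, gorzPolyFourQ5, gorzPolyFourQ6, gorzPolyFourQ7, gorzPolyFourQ8, gorzPolyFourQ9,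
    gorzPolyFourQ10, gorzPolyFourQ11]
  field_simp
  ring

end Literature.NumberTheory.LFunctions
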